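import Summits.Langlands.Langlands.Theorems.PhantomRMYoshidaResiduallyYoshidaLiftingReduction
import Summits.Langlands.Langlands.Theorems.PhantomRMYoshidaResiduallyYoshidaLiftingResidualSplitting
import Literature.NumberTheory.GaloisRepresentations.FrobeniusDensity
import Literature.NumberTheory.Automorphic.ChebotarevArtinRepHolds
import Literature.NumberTheory.GaloisRepresentations.ResidualPairIntegrality
import HarnessLib

/-!
# Route `PhantomRMYoshida`, crux `ResiduallyYoshidaLifting` (stmt-Langlands-13639), line
# `endoscopic-crossing-euler`: the line REDUCED to its two open statements, and the comparison with line
# `yoshida-divisor-selmer-count` (kernel-checked)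

Lead hand-over file for the crux chain (continuation lead c1-0, 2026-08-16), the analogue for line
`endoscopic-crossing-euler` (B) of `…ResiduallyYoshidaLiftingReduction.lean` (line A, lead -0).

With Stubs 1, 2a–2d, 2 of line B LANDED (`…NumericalCriterion`, `…ResidualCharpoly`, `…ResidualTriangular`,
`…BlockSumConj`, `…SplitFrame`, `…ResidualSplitting`) and the registered lever shown inert modulo
pro-automorphy (second lead b-0, `Cruxes/ResiduallyYoshidaLifting/LeadStub3Inert.lean`), the line's skeleton
rev 6 (`Cruxes/ResiduallyYoshidaLifting/Lines/endoscopic_crossing_euler.lean`) has exactly two open registered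
stubs.  This file names them and pins down how they sit against line A's two open statements:

* `Endo`, `OrdLevel`, `ProAut` — line B's vocabulary (verbatim the `let`s of the registered stubs; `Aut`, `Sh`,
  `DetC` are line A's landed `…YoshidaDivisorSelmerCount` vocabulary, themselves verbatim the crux's clauses);
* `ProAutOfSh` — **L1_B**: on every admissible residual fibre, every irreducible `Sh`-representation is
  ordinarily pro-automorphic of some tame level (`∃ S, ProAut S ρ`: for every `n`, `tr ρ` is uniformly
  `p⁻ⁿ`-close to the trace of an automorphic-or-endoscopic, `GSp`-valued, regular-Greenberg-ordinary
  representation unramified outside `S ∪ {p}`).  Absolute form of the registered `stub_proAutomorphy`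
  (`StubProAutomorphy`, verbatim), which it implies (`stubProAutomorphy_of_proAutOfSh`).  OPEN IN PRINT
  (= Λ-adic `R^{ord}_𝔪 = 𝕋^{ord}_𝔪` at the Yoshida `𝔪` with endoscopic components kept; CODIM.md E1′);
* `WeightTwoClassicalityRes` — **L2_B**: the registered `stub_weightTwoClassicality` (verbatim): weight-(2,2)
  classicality + transfer at the Yoshida `𝔪` in Galois form.  OPEN IN PRINT; `≤` route target
  (`weightTwoClassicalityRes_of_phantomRMSector`).

Proved here, sorry-free:

* `norm_trace_sub_le_of_frobPoly` — the bridge between the two lines' notions of "`p`-adic approximant":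
  coefficientwise congruence of the integral Frobenius polynomials of `r`, `r'` outside a finite `S` (line A)
  gives the UNIFORM trace bound `‖tr r'(g) − tr r(g)‖ ≤ c` on all of `Γ_ℚ` (line B) — Chebotarev density of
  Frobenii (`absoluteGaloisGroup.frobenius_dense`, discharged `chebotarev_artinRep_holds`) + closedness;
* `proAut_of_isOrdinaryClassicalLimit` — A's `IsOrdinaryClassicalLimit r` ⟹ B's `∃ S, ProAut S r`;
* `proAutOfSh_of_everyShIsLimit` — **L1_A ⟹ L1_B** (`EveryShIsLimit → ProAutOfSh`);
* `ordinaryLimitClassicality_of_weightTwoClassicalityRes` — **L2_B ⟹ L2_A**;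
* `weightTwoClassicalityRes_of_phantomRMSector` — target ⟹ L2_B (so L2_B carries no risk beyond (B));
* `residuallyYoshidaLifting_of_stubs` — `StubProAutomorphy → WeightTwoClassicalityRes → crux` (the skeleton's
  glue, in the tree), and `phantomRMSector_of_proAutOfSh` — `ProAutOfSh → WeightTwoClassicalityRes →
  PhantomRMSector` (line B is absolute as well: `Aut ρ₀` is never used).

Upshot for the planner (three lead verdicts `promote-stub` on this crux collapse to ONE glued split): the two
lines' residues are comparable — `EveryShIsLimit ⟹ ProAutOfSh` and `WeightTwoClassicalityRes ⟹
OrdinaryLimitClassicality`, both L2's `≤` target — so filing **L1 := `ProAutOfSh`** (the weakest typed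
pro-automorphy statement sufficient for the crux) and **L2 := `WeightTwoClassicalityRes`** serves both lines,
with `phantomRMSector_of_proAutOfSh` / `residuallyYoshidaLifting_of_stubs` as glue.  (The converse
`ProAutOfSh ⟹ EveryShIsLimit` is not formal: B's approximants may be endoscopic, of any regular weight — also
in the (1,3)-chamber, Disproof T4(b) — and are only trace-congruent.)

The registered sub-goal through which this file lands (`--supports stmt-Langlands-13639`) is
`stub_endoscopicResidues`.
-/

noncomputable section

-- `Summit.Langlands.Langlands.…` (summit = sub-problem name, D-0017 layout) trips `dupNamespace` on every decl.
set_option linter.dupNamespace false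
set_option autoImplicit false

open IsDedekindDomain Filter Topology
open scoped NumberField
open Literature.NumberTheory.GaloisRepresentations Literature.NumberTheory.Automorphic
open Summit.Langlands.Langlands.Cruxes.ResiduallyYoshidaLifting.YoshidaDivisorSelmerCount
  (εb DetC Aut Sh IsOrdinaryClassicalLimit EveryShIsLimit OrdinaryLimitClassicality isOdd_of_detC)

namespace Summit.Langlands.Langlands.Cruxes.ResiduallyYoshidaLifting.EndoscopicCrossingEuler

/-! ## Line B vocabulary -/

section Vocabulary

variable (p : ℕ) [Fact p.Prime]

/-- `Endo r` — the ENDOSCOPIC clause of line B (verbatim the registered stubs' `let Endo`): the trace of `r`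
is the sum of the traces of two continuous 2-dimensional representations. [folklore] -/
def Endo (r : FramedGaloisRep ℚ (PadicAlgCl p) 4) : Prop :=
  ∃ r₁ r₂ : FramedGaloisRep ℚ (PadicAlgCl p) 2, ∀ g, (r g).val.trace = (r₁ g).val.trace + (r₂ g).val.trace

/-- `OrdLevel S r` (verbatim the registered stubs' `let OrdLevel`): `r` is Greenberg-ordinary at `p` of
some strictly increasing (regular) shape, unramified outside `S ∪ {p}`, and symplectic for some multiplier.
[cite: BoxerEtAl2021, §7.3 (ordinary of regular weight)] -/
def OrdLevel (S : Finset (HeightOneSpectrum (𝓞 ℚ))) (r : FramedGaloisRep ℚ (PadicAlgCl p) 4) : Prop :=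
  (∃ a : Fin 4 → ℕ, StrictMono a ∧
      ∀ v : HeightOneSpectrum (𝓞 ℚ), ((p : ℕ) : 𝓞 ℚ) ∈ v.asIdeal → r.IsGreenbergOrdinaryOfShapeAt v a) ∧
    (∀ v : HeightOneSpectrum (𝓞 ℚ), ((p : ℕ) : 𝓞 ℚ) ∉ v.asIdeal → v ∉ S → r.IsUnramifiedAt v) ∧
    (∃ ν : Field.absoluteGaloisGroup ℚ → PadicAlgCl p, r.IsSymplecticWithMultiplierFun ν)

/-- `ProAut hcpt ι S ρ` — ORDINARY PRO-AUTOMORPHY OF TAME LEVEL `S` (verbatim the hypothesis of the registered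
`stub_weightTwoClassicality` and the conclusion of `stub_proAutomorphy`): for every `n`, `tr ρ` is uniformly
`p⁻ⁿ`-close on `Γ_ℚ` to the trace of an automorphic-or-endoscopic `r'` with `OrdLevel S r'`.
[cite: BoxerEtAl2021, §7.3] -/
def ProAut (hcpt : isCompact_glFiniteIntegralLevel 4 ℚ) (ι : PadicAlgCl p ≃+* ℂ)
    (S : Finset (HeightOneSpectrum (𝓞 ℚ))) (ρ : FramedGaloisRep ℚ (PadicAlgCl p) 4) : Prop :=
  ∀ n : ℕ, ∃ r' : FramedGaloisRep ℚ (PadicAlgCl p) 4,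
    (Aut p hcpt ι r' ∨ Endo p r') ∧ OrdLevel p S r' ∧
      ∀ g, ‖(r' g).val.trace - (ρ g).val.trace‖ ≤ (p : ℝ) ^ (-(n : ℤ))

end Vocabulary

/-! ## The two open statements of line B, and the absolute form of the first -/

/-- **L1_B `ProAutOfSh`** — on every admissible residual fibre `(p odd, k, red, σ̄, σ̄', hcpt, ι)` (`σ̄, σ̄'`
irreducible, non-conjugate, `det σ̄ = det σ̄' = ε̄⁻¹`), every IRREDUCIBLE `ρ` with `Sh ρ` is ordinarily
pro-automorphic of some tame level.  The absolute core of `stub_proAutomorphy`.  OPEN IN PRINT (Λ-adic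
`R^{ord} = 𝕋^{ord}` at the Yoshida maximal ideal with endoscopic components kept, read at the point of `ρ`,
plus density of regular classical points). -/
def ProAutOfSh : Prop :=
  ∀ (p : ℕ) [Fact p.Prime], p ≠ 2 → ∀ (k : Type) [Field k] [CharP k p] [IsAlgClosed k]
    [TopologicalSpace k] [DiscreteTopology k] (red : Valued.integer (PadicAlgCl p) →+* k)
    (σ σ' : FramedGaloisRep ℚ k 2) (hcpt : isCompact_glFiniteIntegralLevel 4 ℚ) (ι : PadicAlgCl p ≃+* ℂ)
    (ρ : FramedGaloisRep ℚ (PadicAlgCl p) 4),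
    σ.toGaloisRep.IsIrreducible → σ'.toGaloisRep.IsIrreducible → DetC p k σ σ' →
    (¬ ∃ g : GL (Fin 2) k, ∀ x, g * σ x * g⁻¹ = σ' x) →
    ρ.toGaloisRep.IsIrreducible → Sh p k red σ σ' ρ →
    ∃ S : Finset (HeightOneSpectrum (𝓞 ℚ)), ProAut p hcpt ι S ρ

/-- **`StubProAutomorphy`** — the statement of the registered stub `stub_proAutomorphy` of skeleton rev 6,
verbatim (relative form: an automorphic irreducible `ρ₀` on the fibre, and split `ℤ̄_p`-frames of `ρ₀`, `ρ`
— supplied by the landed Stub 2 — are extra hypotheses).  OPEN IN PRINT. -/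
def StubProAutomorphy : Prop :=
  ∀ (p : ℕ) [Fact p.Prime], p ≠ 2 → ∀ (k : Type) [Field k] [CharP k p] [IsAlgClosed k]
    [TopologicalSpace k] [DiscreteTopology k] (red : Valued.integer (PadicAlgCl p) →+* k)
    (σ σ' : Literature.NumberTheory.GaloisRepresentations.FramedGaloisRep ℚ k 2)
    (hcpt : Literature.NumberTheory.Automorphic.isCompact_glFiniteIntegralLevel 4 ℚ)
    (ι : PadicAlgCl p ≃+* ℂ)
    (ρ₀ ρ : Literature.NumberTheory.GaloisRepresentations.FramedGaloisRep ℚ (PadicAlgCl p) 4),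
    let Endo := fun r : Literature.NumberTheory.GaloisRepresentations.FramedGaloisRep ℚ (PadicAlgCl p) 4 =>
      (∃ r₁ r₂ : Literature.NumberTheory.GaloisRepresentations.FramedGaloisRep ℚ (PadicAlgCl p) 2,
        ∀ g, (r g).val.trace = (r₁ g).val.trace + (r₂ g).val.trace);
    let OrdLevel := fun (S : Finset (IsDedekindDomain.HeightOneSpectrum (NumberField.RingOfIntegers ℚ)))
        (r : Literature.NumberTheory.GaloisRepresentations.FramedGaloisRep ℚ (PadicAlgCl p) 4) =>
      ((∃ a : Fin 4 → ℕ, StrictMono a ∧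
          ∀ v : IsDedekindDomain.HeightOneSpectrum (NumberField.RingOfIntegers ℚ),
            ((p : ℕ) : NumberField.RingOfIntegers ℚ) ∈ v.asIdeal → r.IsGreenbergOrdinaryOfShapeAt v a) ∧
        (∀ v : IsDedekindDomain.HeightOneSpectrum (NumberField.RingOfIntegers ℚ),
          ((p : ℕ) : NumberField.RingOfIntegers ℚ) ∉ v.asIdeal → v ∉ S → r.IsUnramifiedAt v) ∧
        (∃ ν : Field.absoluteGaloisGroup ℚ → PadicAlgCl p, r.IsSymplecticWithMultiplierFun ν));
    let SplitFrame := fun r : Literature.NumberTheory.GaloisRepresentations.FramedGaloisRep ℚ (PadicAlgCl p) 4 =>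
      (∃ (P : GL (Fin 4) (PadicAlgCl p))
        (rint : Field.absoluteGaloisGroup ℚ →* GL (Fin 4) (Valued.integer (PadicAlgCl p)))
        (h : GL (Fin 4) k),
        (∀ g, Matrix.GeneralLinearGroup.map (Valued.integer (PadicAlgCl p)).subtype (rint g) =
          P⁻¹ * r g * P) ∧
        (∀ g, (Matrix.GeneralLinearGroup.map red (rint g)).val =
          h.val * Matrix.reindex finSumFinEquiv finSumFinEquiv
            (Matrix.fromBlocks (σ g).val 0 0 (σ' g).val) * (h⁻¹).val));
    σ.toGaloisRep.IsIrreducible → σ'.toGaloisRep.IsIrreducible →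
    Summit.Langlands.Langlands.Cruxes.ResiduallyYoshidaLifting.YoshidaDivisorSelmerCount.DetC p k σ σ' →
    (¬ ∃ g : GL (Fin 2) k, ∀ x, g * σ x * g⁻¹ = σ' x) →
    ρ₀.toGaloisRep.IsIrreducible →
    Summit.Langlands.Langlands.Cruxes.ResiduallyYoshidaLifting.YoshidaDivisorSelmerCount.Sh p k red σ σ' ρ₀ →
    Summit.Langlands.Langlands.Cruxes.ResiduallyYoshidaLifting.YoshidaDivisorSelmerCount.Aut p hcpt ι ρ₀ →
    ρ.toGaloisRep.IsIrreducible →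
    Summit.Langlands.Langlands.Cruxes.ResiduallyYoshidaLifting.YoshidaDivisorSelmerCount.Sh p k red σ σ' ρ →
    SplitFrame ρ₀ → SplitFrame ρ →
    ∃ S : Finset (IsDedekindDomain.HeightOneSpectrum (NumberField.RingOfIntegers ℚ)),
      ∀ n : ℕ, ∃ r' : Literature.NumberTheory.GaloisRepresentations.FramedGaloisRep ℚ (PadicAlgCl p) 4,
        (Summit.Langlands.Langlands.Cruxes.ResiduallyYoshidaLifting.YoshidaDivisorSelmerCount.Aut p hcpt ι r' ∨ Endo r') ∧
          OrdLevel S r' ∧ ∀ g, ‖(r' g).val.trace - (ρ g).val.trace‖ ≤ (p : ℝ) ^ (-(n : ℤ))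

/-- **L2_B `WeightTwoClassicalityRes`** — the statement of the registered stub `stub_weightTwoClassicality`
(rev ≥ 3, residual data restored), verbatim: an irreducible, symplectic-`ε⁻¹`, Greenberg-`(0,0,1,1)`,
`p`-distinguished, residually-`σ̄ ⊕ σ̄'` representation which is ordinarily pro-automorphic of tame level `S`
is automorphic.  OPEN IN PRINT; implied by the route target (`weightTwoClassicalityRes_of_phantomRMSector`). -/
def WeightTwoClassicalityRes : Prop :=
  ∀ (p : ℕ) [Fact p.Prime], p ≠ 2 → ∀ (k : Type) [Field k] [CharP k p] [IsAlgClosed k]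
    [TopologicalSpace k] [DiscreteTopology k] (red : Valued.integer (PadicAlgCl p) →+* k)
    (σ σ' : Literature.NumberTheory.GaloisRepresentations.FramedGaloisRep ℚ k 2)
    (hcpt : Literature.NumberTheory.Automorphic.isCompact_glFiniteIntegralLevel 4 ℚ)
    (ι : PadicAlgCl p ≃+* ℂ)
    (S : Finset (IsDedekindDomain.HeightOneSpectrum (NumberField.RingOfIntegers ℚ)))
    (ρ : Literature.NumberTheory.GaloisRepresentations.FramedGaloisRep ℚ (PadicAlgCl p) 4),
    let εb : Field.absoluteGaloisGroup ℚ →* (ZMod p)ˣ := (modularCyclotomicCharacter (AlgebraicClosure ℚ)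
        (HasEnoughRootsOfUnity.natCard_rootsOfUnity (AlgebraicClosure ℚ) p)).comp
        (MulSemiringAction.toRingAut (Field.absoluteGaloisGroup ℚ) (AlgebraicClosure ℚ))
    let Aut := fun r : Literature.NumberTheory.GaloisRepresentations.FramedGaloisRep ℚ (PadicAlgCl p) 4 =>
      (∃ π : Literature.NumberTheory.Automorphic.CuspidalAutomorphicRepData 4 ℚ hcpt, π.1.IsLAlgebraic ∧
        ∀ᶠ v : IsDedekindDomain.HeightOneSpectrum (NumberField.RingOfIntegers ℚ) in Filter.cofinite,
          ∃ a : Multiset ℂ, π.1.HasSatakeParamAt v a ∧ r.IsUnramifiedAt v ∧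
            r.HasFrobCharpolyAt v
              (Literature.NumberTheory.Automorphic.arithFrobPolyOfSatake ι v.residueCard 1 a))
    let Endo := fun r : Literature.NumberTheory.GaloisRepresentations.FramedGaloisRep ℚ (PadicAlgCl p) 4 =>
      (∃ r₁ r₂ : Literature.NumberTheory.GaloisRepresentations.FramedGaloisRep ℚ (PadicAlgCl p) 2,
        ∀ g, (r g).val.trace = (r₁ g).val.trace + (r₂ g).val.trace)
    let OrdLevel := fun (S : Finset (IsDedekindDomain.HeightOneSpectrum (NumberField.RingOfIntegers ℚ)))
        (r : Literature.NumberTheory.GaloisRepresentations.FramedGaloisRep ℚ (PadicAlgCl p) 4) =>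
      ((∃ a : Fin 4 → ℕ, StrictMono a ∧
          ∀ v : IsDedekindDomain.HeightOneSpectrum (NumberField.RingOfIntegers ℚ),
            ((p : ℕ) : NumberField.RingOfIntegers ℚ) ∈ v.asIdeal → r.IsGreenbergOrdinaryOfShapeAt v a) ∧
        (∀ v : IsDedekindDomain.HeightOneSpectrum (NumberField.RingOfIntegers ℚ),
          ((p : ℕ) : NumberField.RingOfIntegers ℚ) ∉ v.asIdeal → v ∉ S → r.IsUnramifiedAt v) ∧
        (∃ ν : Field.absoluteGaloisGroup ℚ → PadicAlgCl p, r.IsSymplecticWithMultiplierFun ν))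
    σ.IsOdd → σ'.IsOdd → σ.toGaloisRep.IsIrreducible → σ'.toGaloisRep.IsIrreducible →
    (∀ g, Literature.NumberTheory.GaloisRepresentations.FramedRep.det σ g =
        (Units.map (ZMod.castHom (dvd_refl p) k).toMonoidHom (εb g))⁻¹ ∧
      Literature.NumberTheory.GaloisRepresentations.FramedRep.det σ' g =
        Literature.NumberTheory.GaloisRepresentations.FramedRep.det σ g) →
    (¬ ∃ g : GL (Fin 2) k, ∀ x, g * σ x * g⁻¹ = σ' x) →
    ρ.toGaloisRep.IsIrreducible →
    ρ.IsSymplecticWithMultiplierFun (fun g => algebraMap ℚ_[p] (PadicAlgCl p)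
      ((((Literature.NumberTheory.GaloisRepresentations.GaloisRep.cyclotomicCharacter ℚ p g)⁻¹ :
        ℤ_[p]ˣ) : ℤ_[p]) : ℚ_[p])) →
    (∀ v : IsDedekindDomain.HeightOneSpectrum (NumberField.RingOfIntegers ℚ),
      ((p : ℕ) : NumberField.RingOfIntegers ℚ) ∈ v.asIdeal →
        ρ.IsGreenbergOrdinaryOfShapeAt v ![0, 0, 1, 1] ∧ ρ.IsResiduallyDistinguishedAt v ![0, 0, 1, 1]) →
    (∀ᶠ v : IsDedekindDomain.HeightOneSpectrum (NumberField.RingOfIntegers ℚ) in Filter.cofinite,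
      ρ.IsUnramifiedAt v ∧ σ.IsUnramifiedAt v ∧ σ'.IsUnramifiedAt v ∧
      ∃ (P : Polynomial (Valued.integer (PadicAlgCl p))) (P₁ P₂ : Polynomial k),
        ρ.HasFrobCharpolyAt v (P.map (Valued.integer (PadicAlgCl p)).subtype) ∧
        σ.HasFrobCharpolyAt v P₁ ∧ σ'.HasFrobCharpolyAt v P₂ ∧ P.map red = P₁ * P₂) →
    (∀ n : ℕ, ∃ r' : Literature.NumberTheory.GaloisRepresentations.FramedGaloisRep ℚ (PadicAlgCl p) 4,
      (Aut r' ∨ Endo r') ∧ OrdLevel S r' ∧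
        ∀ g, ‖(r' g).val.trace - (ρ g).val.trace‖ ≤ (p : ℝ) ^ (-(n : ℤ))) →
    Aut ρ

/-! ## The bridge: Frobenius-polynomial congruence off `S` ⟹ uniform trace bound (Chebotarev) -/

section Bridge

variable {p : ℕ} [Fact p.Prime]

/-- The trace of `r(g)` is minus the `X³`-coefficient of the integral Frobenius polynomial, at any arithmetic
Frobenius `g` of an unramified place. [folklore] -/
theorem trace_eq_neg_coeff_of_hasFrobCharpolyAt {v : HeightOneSpectrum (𝓞 ℚ)}
    {r : FramedGaloisRep ℚ (PadicAlgCl p) 4} (hr : r.IsUnramifiedAt v)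
    {P : Polynomial (Valued.integer (PadicAlgCl p))}
    (hP : r.HasFrobCharpolyAt v (P.map (Valued.integer (PadicAlgCl p)).subtype))
    {𝔓 : Ideal (absIntegers (𝓞 ℚ) ℚ)} (h𝔓 : 𝔓 ∈ v.primesAbove)
    {g : Field.absoluteGaloisGroup ℚ} (hg : IsArithFrobAt (𝓞 ℚ) g 𝔓) :
    (r g).val.trace = -((P.coeff 3 : Valued.integer (PadicAlgCl p)) : PadicAlgCl p) := by
  have h1 : P.map (Valued.integer (PadicAlgCl p)).subtype = FramedRep.charpoly r g :=
    hP.unique (hr.hasFrobCharpolyAt_charpoly h𝔓 hg)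
  have h2 : (r g).val.trace = -(FramedRep.charpoly r g).coeff (Fintype.card (Fin 4) - 1) :=
    Matrix.trace_eq_neg_charpoly_coeff _
  rw [h2, ← h1, Polynomial.coeff_map]
  rfl

/-- **The bridge between the two lines' approximants.**  If `r`, `r'` are unramified outside a finite set `S`
of places and, at every `v ∉ S`, have integral Frobenius polynomials whose coefficients are `c`-close, then
`‖tr r'(g) − tr r(g)‖ ≤ c` for EVERY `g ∈ Γ_ℚ`: the inequality holds at every arithmetic Frobenius outside `S`
(`trace_eq_neg_coeff_of_hasFrobCharpolyAt`), these are dense (`absoluteGaloisGroup.frobenius_dense` from the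
discharged Chebotarev theorem `chebotarev_artinRep_holds`), and the set where it holds is closed.
[cite: SerreAbelianLadic1968, Ch. I §2.2 Cor. 2 (a)] -/
theorem norm_trace_sub_le_of_frobPoly {S : Set (HeightOneSpectrum (𝓞 ℚ))} (hS : S.Finite)
    {r r' : FramedGaloisRep ℚ (PadicAlgCl p) 4} {c : ℝ}
    (h : ∀ v ∉ S, r.IsUnramifiedAt v ∧ r'.IsUnramifiedAt v ∧
      ∃ P P' : Polynomial (Valued.integer (PadicAlgCl p)),
        r.HasFrobCharpolyAt v (P.map (Valued.integer (PadicAlgCl p)).subtype) ∧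
        r'.HasFrobCharpolyAt v (P'.map (Valued.integer (PadicAlgCl p)).subtype) ∧
        ∀ i : ℕ, ‖((P.coeff i : Valued.integer (PadicAlgCl p)) : PadicAlgCl p) -
            ((P'.coeff i : Valued.integer (PadicAlgCl p)) : PadicAlgCl p)‖ ≤ c)
    (g : Field.absoluteGaloisGroup ℚ) : ‖(r' g).val.trace - (r g).val.trace‖ ≤ c := by
  have hD := absoluteGaloisGroup.frobenius_dense chebotarev_artinRep_holds ℚ S hS
  -- the set where the bound holds is closed (both traces are continuous in `g`)
  have hcont : Continuous fun g : Field.absoluteGaloisGroup ℚ => ‖(r' g).val.trace - (r g).val.trace‖ :=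
    ((FramedRep.continuous_trace r').sub (FramedRep.continuous_trace r)).norm
  have hE : IsClosed {g : Field.absoluteGaloisGroup ℚ | ‖(r' g).val.trace - (r g).val.trace‖ ≤ c} :=
    isClosed_le hcont continuous_const
  -- and it contains the (dense) Frobenii outside `S`
  refine hE.closure_subset_iff.2 (fun x hx => ?_) (hD g)
  obtain ⟨v, hv, 𝔓, h𝔓, hx⟩ := hx
  obtain ⟨hr, hr', P, P', hP, hP', hcoeff⟩ := h v hv
  change ‖(r' x).val.trace - (r x).val.trace‖ ≤ c
  rw [trace_eq_neg_coeff_of_hasFrobCharpolyAt hr hP h𝔓 hx,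
    trace_eq_neg_coeff_of_hasFrobCharpolyAt hr' hP' h𝔓 hx, neg_sub_neg]
  exact hcoeff 3

/-- `‖p‖ⁿ = p⁻ⁿ` in `ℚ̄_p`. [folklore] -/
theorem norm_p_pow (n : ℕ) : ‖(p : PadicAlgCl p)‖ ^ n = (p : ℝ) ^ (-(n : ℤ)) := by
  have h : ‖(p : PadicAlgCl p)‖ = (p : ℝ)⁻¹ := by
    have := congrArg (fun x : NNReal => (x : ℝ)) (PadicAlgCl.valuation_p p)
    simpa [PadicAlgCl.valuation_coe] using this
  rw [h, zpow_neg, zpow_natCast, inv_pow]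

/-- **Line A's approximants are line B's**: an ordinary classical limit (`IsOrdinaryClassicalLimit`, line A)
is ordinarily pro-automorphic of some tame level (`∃ S, ProAut S r`, line B) — automorphic approximants are
automorphic-or-endoscopic, a shape in the (2,2)-chamber is in particular strictly increasing, and the
Frobenius-polynomial congruence off `S` gives the uniform trace bound (`norm_trace_sub_le_of_frobPoly`). -/
theorem proAut_of_isOrdinaryClassicalLimit {hcpt : isCompact_glFiniteIntegralLevel 4 ℚ}
    {ι : PadicAlgCl p ≃+* ℂ} {r : FramedGaloisRep ℚ (PadicAlgCl p) 4}
    (h : IsOrdinaryClassicalLimit p hcpt ι r) :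
    ∃ S : Finset (HeightOneSpectrum (𝓞 ℚ)), ProAut p hcpt ι S r := by
  obtain ⟨S, hS, hlim⟩ := h
  refine ⟨hS.toFinset, fun n => ?_⟩
  obtain ⟨r', a, hAut, hmono, -, hsymp, hord, hfrob⟩ := hlim n
  refine ⟨r', Or.inl hAut, ⟨⟨a, hmono, fun v hv => (hord v hv).1⟩, fun v _ hvS => ?_, hsymp⟩, fun g => ?_⟩
  · exact (hfrob v fun hvS' => hvS (hS.mem_toFinset.2 hvS')).2.1
  · rw [← norm_p_pow]
    exact norm_trace_sub_le_of_frobPoly hS hfrob g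

end Bridge

/-! ## L1_A ⟹ L1_B ⟹ the registered stub; L2_B ⟹ L2_A; target ⟹ L2_B -/

/-- **L1_A ⟹ L1_B**: `EveryShIsLimit → ProAutOfSh`. -/
theorem proAutOfSh_of_everyShIsLimit (h : EveryShIsLimit) : ProAutOfSh := by
  intro p _ hp k _ _ _ _ _ red σ σ' hcpt ι ρ hσ hσ' hdet hnc hρ hSh
  exact proAut_of_isOrdinaryClassicalLimit (h p hp k red σ σ' hcpt ι ρ hσ hσ' hdet hnc hρ hSh)

/-- **L1_B ⟹ the registered stub**: `ProAutOfSh → StubProAutomorphy` (the automorphic point `ρ₀` and the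
split frames are simply not used). -/
theorem stubProAutomorphy_of_proAutOfSh (h : ProAutOfSh) : StubProAutomorphy := by
  intro p _ hp k _ _ _ _ _ red σ σ' hcpt ι ρ₀ ρ _ _ _ hσ hσ' hdet hnc _ _ _ hρ hSh _ _
  exact h p hp k red σ σ' hcpt ι ρ hσ hσ' hdet hnc hρ hSh

/-- **L2_B ⟹ L2_A**: `WeightTwoClassicalityRes → OrdinaryLimitClassicality` (oddness of `σ̄, σ̄'` from
`det = ε̄⁻¹`, `isOdd_of_detC`; the limit hypothesis through `proAut_of_isOrdinaryClassicalLimit`). -/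
theorem ordinaryLimitClassicality_of_weightTwoClassicalityRes (h : WeightTwoClassicalityRes) :
    OrdinaryLimitClassicality := by
  intro p _ hp k _ _ _ _ _ red σ σ' hcpt ι r hσ hσ' hdet hnc hirr hSh hlim
  obtain ⟨hodd, hodd'⟩ := isOdd_of_detC hdet
  obtain ⟨S, hS⟩ := proAut_of_isOrdinaryClassicalLimit hlim
  exact h p hp k red σ σ' hcpt ι S r hodd hodd' hσ hσ' hdet hnc hirr hSh.1 hSh.2.1 hSh.2.2 hS

/-- **target ⟹ L2_B**: the route target `PhantomRMSector` implies `WeightTwoClassicalityRes` (the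
pro-automorphy hypothesis is discarded), so L2_B is false only if conjunct (B) is. -/
theorem weightTwoClassicalityRes_of_phantomRMSector
    (h : Summit.Langlands.Langlands.Theses.PhantomRMYoshida.PhantomRMSector) : WeightTwoClassicalityRes := by
  intro p _ hp k _ _ _ _ _ red σ σ' hcpt ι S ρ _ _ _ _ hodd hodd' hσ hσ' hdet hnc hirr hsymp hord hae _
  exact h p hp k red σ σ' hcpt ι ρ hodd hodd' hσ hσ' hdet hnc hirr ⟨hsymp, hord, hae⟩

/-! ## The glue: the crux (and the target) from the two open statements -/

/-- **The skeleton's composition, in the tree**: `StubProAutomorphy → WeightTwoClassicalityRes →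
ResiduallyYoshidaLifting` — split integral frames of `ρ₀`, `ρ` from the LANDED Stub 2
(`stub_residualYoshidaSplitting`), then pro-automorphy, then classicality. -/
theorem residuallyYoshidaLifting_of_stubs (h3 : StubProAutomorphy) (h4 : WeightTwoClassicalityRes) :
    Summit.Langlands.Langlands.Theses.PhantomRMYoshida.ResiduallyYoshidaLifting := by
  refine fun p _ hp k _ _ _ _ _ red σ σ' hcpt ι ρ₀ ρ hσ hσ' hirr hirr' hdet hnc hρ₀irr hSh₀ hAut₀ hρirr hSh => ?_
  obtain ⟨P₀, r₀int, h₀, hP₀, hred₀⟩ :=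
    stub_residualYoshidaSplitting p hp k red σ σ' ρ₀ hirr hirr' hdet hnc hρ₀irr hSh₀.1 hSh₀.2.2
  obtain ⟨P, rint, hh, hP, hred⟩ :=
    stub_residualYoshidaSplitting p hp k red σ σ' ρ hirr hirr' hdet hnc hρirr hSh.1 hSh.2.2
  obtain ⟨S, hpro⟩ :=
    h3 p hp k red σ σ' hcpt ι ρ₀ ρ hirr hirr' hdet hnc hρ₀irr hSh₀ hAut₀ hρirr hSh
      ⟨P₀, r₀int, h₀, hP₀, hred₀⟩ ⟨P, rint, hh, hP, hred⟩
  exact h4 p hp k red σ σ' hcpt ι S ρ hσ hσ' hirr hirr' hdet hnc hρirr hSh.1 hSh.2.1 hSh.2.2 hpro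

/-- **Line B is absolute**: `ProAutOfSh → WeightTwoClassicalityRes → PhantomRMSector` (the route TARGET; the
automorphic point `ρ₀` of the crux is never used). -/
theorem phantomRMSector_of_proAutOfSh (h1 : ProAutOfSh) (h4 : WeightTwoClassicalityRes) :
    Summit.Langlands.Langlands.Theses.PhantomRMYoshida.PhantomRMSector := by
  intro p _ hp k _ _ _ _ _ red σ σ' hcpt ι ρ _ hodd hodd' hσ hσ' hdet hnc hirr hSh
  obtain ⟨S, hS⟩ := h1 p hp k red σ σ' hcpt ι ρ hσ hσ' hdet hnc hirr hSh
  exact h4 p hp k red σ σ' hcpt ι S ρ hodd hodd' hσ hσ' hdet hnc hirr hSh.1 hSh.2.1 hSh.2.2 hS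

/-- Hence also `ProAutOfSh → WeightTwoClassicalityRes → ResiduallyYoshidaLifting` (through
`stubProAutomorphy_of_proAutOfSh`). -/
theorem residuallyYoshidaLifting_of_proAutOfSh (h1 : ProAutOfSh) (h4 : WeightTwoClassicalityRes) :
    Summit.Langlands.Langlands.Theses.PhantomRMYoshida.ResiduallyYoshidaLifting :=
  residuallyYoshidaLifting_of_stubs (stubProAutomorphy_of_proAutOfSh h1) h4

/-- **Registered sub-goal `stub_endoscopicResidues`** (the conjunction through which this file lands): the
two lines' open residues compared and glued — L1_A ⟹ L1_B, L2_B ⟹ L2_A, (L1_B ∧ L2_B) ⟹ target, and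
(registered Stub 3′ ∧ registered Stub 4) ⟹ crux. -/
theorem stub_endoscopicResidues :
    (EveryShIsLimit → ProAutOfSh) ∧
    (WeightTwoClassicalityRes → OrdinaryLimitClassicality) ∧
    (ProAutOfSh → WeightTwoClassicalityRes →
      Summit.Langlands.Langlands.Theses.PhantomRMYoshida.PhantomRMSector) ∧
    (StubProAutomorphy → WeightTwoClassicalityRes →
      Summit.Langlands.Langlands.Theses.PhantomRMYoshida.ResiduallyYoshidaLifting) :=
  ⟨proAutOfSh_of_everyShIsLimit, ordinaryLimitClassicality_of_weightTwoClassicalityRes,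
    phantomRMSector_of_proAutOfSh, residuallyYoshidaLifting_of_stubs⟩

end Summit.Langlands.Langlands.Cruxes.ResiduallyYoshidaLifting.EndoscopicCrossingEuler

end
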